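import Summits.BirchSwinnertonDyer.BirchSwinnertonDyer.Theorems.SchneiderFreeAdditiveX3AnticyclotomicTowerTorsion
import Summits.BirchSwinnertonDyer.BirchSwinnertonDyer.Theorems.SchneiderFreeAdditiveX3AnticycControlAdditiveTorsionExponents
import HarnessLib

/-!
# Crux `AnticycControlAdditiveK` (route `SchneiderFreeAdditiveX3`, stmt-BirchSwinnertonDyer-19295):
# the registered stub `stub_kerRes` (KER-res) of skeleton v3-K, PROVED

Seat `bsd-schneider-door-c5` (cell `bsd-schneider-ideate`), gen 4. The atom (KER-res) of door-c4's
torsion-robust control count (`additiveControlOnTreeAt_of_torsAtoms`, p419833 / p420051) — "the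
kernel of `res : H¹(K, E[p^∞]) → H¹(K_∞, E[p^∞])` has order `p^g` for some `g`" — registered by the
route base unit P2 g8 as `stub_kerRes` of the skeleton v3-K «torsAtoms shape» (sha16 c0242a50) on the
crux `AnticycControlAdditiveK`, with the SIGNATURE VERBATIM. Proof: door-c4's identification
`natCard_ker_resOfLe_top_eq_natCard_fixedPoints` (`#ker res = #E_K[p^∞]^{Γ_K}` granted the finiteness of
`E(K_∞)[p^∞]`), the finiteness now being the THEOREM
`finite_fixedPoints_kerSubgroup_of_not_dvd_torsionOrder` of
`SchneiderFreeAdditiveX3AnticyclotomicTowerTorsion.lean` (`E(K_∞^{ac})[p^∞] = E(K)[p^∞]` for `p` odd,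
`K` imaginary quadratic with `p ∤ #μ(K)`, `κ` anticyclotomic — all three are binders of the stub), and
the count of the finite `p`-group `E_K[p^∞]^{Γ_K}`. So `g = ord_p #E(K)[p^∞]` (the GLOBAL torsion
exponent, uniformly on both regimes `E(K)[p] = 0` / `≠ 0` of the cell's control corner). Of the stub's
binders only `p ≠ 2`, `IsImaginaryQuadratic K`, `¬ p ∣ torsionOrder K` and `κ.IsAnticyclotomic` are used.

Theorems only; no `Prop` fact; no `sorry`; closes nothing by itself (one of six registered stubs of
the crux); BSD is not proved by any of this.

References: [GreenbergLNM1716] §3 Lemma 3.1 (p. 86), §4 Lemma 4.3 (p. 103).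
-/

noncomputable section

open scoped Classical

open WeierstrassCurve NumberField IsDedekindDomain Field Literature.NumberTheory.EllipticCurves
  Literature.NumberTheory.EllipticCurves.ModularForms
  Literature.NumberTheory.EllipticCurves.GreenbergSelmer
  Literature.NumberTheory.GaloisRepresentations
  Literature.NumberTheory.EllipticCurves.Rank1Residual
  Literature.NumberTheory.EllipticCurves.Rank1Residual.Typed
  Summit.BirchSwinnertonDyer.Rank1Residual
  Summit.BirchSwinnertonDyer.Rank1Residual.X11b
  Summit.BirchSwinnertonDyer.Rank1Residual.X11b.AcSelmer
  Summit.BirchSwinnertonDyer.BirchSwinnertonDyer.Theorems.SchneiderFree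
  Summit.BirchSwinnertonDyer.BirchSwinnertonDyer.Theorems.SchneiderFreeControlAtoms

set_option linter.dupNamespace false

namespace Summit.BirchSwinnertonDyer.BirchSwinnertonDyer.Theorems.SchneiderFreeAdditiveX3

/-- **The `Γ_K`-fixed points of `E_K[p^∞]` form a finite `p`-group: `#E_K[p^∞]^{Γ_K} = p^g`.**
(`finite_fixedPoints_geomPrimaryTorsion`: they are `K`-rational torsion, finite by Mordell–Weil; every
element is killed by a power of `p`.) [folklore] -/
theorem exists_natCard_fixedPoints_geomPrimaryTorsion_eq_pow {K : Type} [Field K] [NumberField K]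
    (W : WeierstrassCurve K) [W.IsElliptic] (p : ℕ) [Fact p.Prime] :
    ∃ g : ℕ, Nat.card {m : geomPrimaryTorsion W p | ∀ σ : absoluteGaloisGroup K, σ • m = m} =
      p ^ g := by
  set S : AddSubgroup (geomPrimaryTorsion W p) :=
    FixedPoints.addSubgroup (absoluteGaloisGroup K) (geomPrimaryTorsion W p) with hS
  have hmemS : ∀ m, m ∈ S ↔ ∀ σ : absoluteGaloisGroup K, σ • m = m := fun m ↦
    FixedPoints.mem_addSubgroup _ _ m
  haveI : Finite S := by
    have hfin := W.finite_fixedPoints_geomPrimaryTorsion p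
    have hsub : ((S : AddSubgroup (geomPrimaryTorsion W p)) : Set (geomPrimaryTorsion W p)) ⊆
        {m | ∀ σ : absoluteGaloisGroup K, σ • m = m} := fun m hm ↦ (hmemS m).mp hm
    exact (hfin.subset hsub).to_subtype
  have hPS : IsPGroup p (Multiplicative S) := fun x ↦ by
    obtain ⟨k, hk⟩ := ((Multiplicative.toAdd x : S) : geomPrimaryTorsion W p).2
    refine ⟨k, ?_⟩
    change Multiplicative.ofAdd (p ^ k • (Multiplicative.toAdd x)) = Multiplicative.ofAdd 0
    congr 1
    apply Subtype.ext
    apply Subtype.ext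
    rw [AddSubmonoidClass.coe_nsmul, ZeroMemClass.coe_zero, AddSubmonoidClass.coe_nsmul,
      ZeroMemClass.coe_zero]
    exact hk
  obtain ⟨g, hg⟩ := IsPGroup.iff_card.mp hPS
  refine ⟨g, ?_⟩
  have hcard : Nat.card {m : geomPrimaryTorsion W p | ∀ σ : absoluteGaloisGroup K, σ • m = m} =
      Nat.card S :=
    Nat.card_congr (Equiv.subtypeEquivRight fun m ↦ (hmemS m).symm)
  rw [hcard]
  exact hg

/-- **Registered stub `stub_kerRes` of crux `AnticycControlAdditiveK` (skeleton v3-K), signature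
verbatim: `#ker(H¹(K, E[p^∞]) → H¹(K_∞, E[p^∞])) = p^g` for some `g`** on every B6 Heegner datum and
anticyclotomic frame. Proof: `E(K_∞^{ac})[p^∞]` is finite (indeed `= E(K)[p^∞]`,
`finite_fixedPoints_kerSubgroup_of_not_dvd_torsionOrder`: `p ≠ 2`, `K` imaginary quadratic,
`p ∤ #μ(K)`, `κ` anticyclotomic), so door-c4's `natCard_ker_resOfLe_top_eq_natCard_fixedPoints` gives
`#ker res = #E_K[p^∞]^{Γ_K}`, a `p`-power (`exists_natCard_fixedPoints_geomPrimaryTorsion_eq_pow`);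
`g = ord_p #E(K)[p^∞]`. [cite: GreenbergLNM1716, §4 Lemma 4.3 (p. 103)] -/
theorem stub_kerRes :
    ∀ (W : WeierstrassCurve ℚ) [W.IsElliptic] [W.IsGloballyMinimal] (p : ℕ) [Fact p.Prime],
      W.analyticRank = 1 → p ≠ 2 → ClassX3 W p → Additive.SubSemistableTwist W p →
      ∀ (N : ℕ) [NeZero N] (K : Type) [Field K] [NumberField K]
        (Dt : ModularParametrizationData W N) (H : HeegnerDatum N (NumberField.discr K)) (ι : K →+* ℂ)
        (P : (W.baseChange K).toAffine.Point),
        W.analyticRank = 1 → Additive.N10.Locus W p → W.conductorNorm ℤ = N →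
        ∀ hK : IsImaginaryQuadratic K,
        Odd (NumberField.discr K) → ¬ p ∣ Units.torsionOrder K → SatisfiesHeegnerHypothesis N K →
        (W.quadraticTwist (NumberField.discr K : ℚ)).entireLFunction 1 ≠ 0 →
        WeierstrassCurve.Affine.Point.map ι.toRatAlgHom P = heegnerPointComplex Dt H →
        ¬ IsOfFinAddOrder P →
        ∀ (κ : ZpExtension K p), κ.IsAnticyclotomic →
          ∀ (γ : Field.absoluteGaloisGroup K) [Fact (κ.IsTopGenerator γ)]
            (𝔭 : HeightOneSpectrum (𝓞 K)) (h𝔭 : ((p : ℕ) : 𝓞 K) ∈ 𝔭.asIdeal)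
            (he : 𝔭.asIdeal.ramificationIdx (𝓞 ℚ) = 1) (hf : 𝔭.asIdeal.inertiaDeg (𝓞 ℚ) = 1),
            ∃ g : ℕ, Nat.card ((W.baseChange K).resOfLe p (le_top : κ.kerSubgroup ≤ ⊤)).ker = p ^ g := by
  intro W _ _ p _ _ hp2 _ _ N _ K _ _ Dt H ι P _ _ _ hK _ hunit _ _ _ _ κ hκ γ _ 𝔭 h𝔭 he hf
  haveI := finite_fixedPoints_kerSubgroup_of_not_dvd_torsionOrder W p κ hp2 hK hunit hκ
  rw [natCard_ker_resOfLe_top_eq_natCard_fixedPoints (W.baseChange K) p κ]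
  exact exists_natCard_fixedPoints_geomPrimaryTorsion_eq_pow (W.baseChange K) p

end Summit.BirchSwinnertonDyer.BirchSwinnertonDyer.Theorems.SchneiderFreeAdditiveX3

end
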